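import Mathlib
import HarnessLib
import Summits.HubbardSuperconductivity.HubbardSuperconductivity.Theorems.KLProgrammeKLRegimeTwoVolumeTowerTruncProfileReadout
import Summits.HubbardSuperconductivity.HubbardSuperconductivity.Theorems.KLProgrammeKLRegimeTwoVolumeSourceProfileDefsF

/-!
# Route `KLProgramme` — crux K3, VL child `KLRegimeVolumeLimitV17F3` (stmt-HubbardSuperconductivity-23356), cure of LR13′ «(VL)-HUV-CURRENCY-PROPAGATION»:
# THE ELEMENTARY KIT OF THE FAMILY-GENERIC CARRIERS (seat hubbard-kl-k3c4-p1 g20; `--supports` 23356)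

The `F`-twins (source copy analysed by an arbitrary one-sector family `F`, `…TwoVolumeSourceProfileDefsF`) of the elementary facts the blocked source tower
and the profile bridges use about the plain carriers:
* rows/kernels: `klSrcAnalysisAtF_row_alive/_row_src`, `kernel_klSrcActionAtF_alive` (all-alive strings read the `F_J`-sectorised kernels — `F`-free),
  `kernel_klSrcActionAtF_src`, `kernel_klSrcActionAtF_eq_zero_of_dead`, `smul_klSrcAnalysisAtF_apply`, `kernel_map_smul_klSrcAnalysisAtF`;
* parity: `klSrcActionAtF_mem_evenPart`, `klSrcPinnedSumAtF_eq_zero_of_odd`, `klTowerDF_parity`;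
* the read-out's species sums: `norm_kernel_klTowerDF_eq`, `sum_srcCount_filter_eq_eps_mul_klSrcPinnedSumAtF`;
* comparisons: `klSrcPinnedSumAtF_anti_rate` (rate monotonicity), `klSrcPinnedSumAtF_zero_le_klWtPinnedSumAt` (the alive species is E1's read-out, `F`-free).
Proofs only (the plain proofs verbatim: `…SourceReadoutAt`, `…V9GluedSrcPairDoorAt`, `…SrcTowerUnits`, `…TowerGenericFacts`, `…TowerTruncProfileBridge`,
`…TowerTruncProfileReadout`); no definition; nothing about the model's sizes is asserted. [cite: BenfattoGiulianiMastropietro2006, §2.7 (2.70)-(2.71), §2.9 (4.3)-(4.8)]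
-/

noncomputable section

namespace Summit.HubbardSuperconductivity.HubbardSuperconductivity.Theorems.TwoVolumeSource

set_option linter.dupNamespace false -- summit = problem name (single-conjunct summit), D-0017

open Finset Literature.MathematicalPhysics.QuantumLattice Literature.Probability.LatticeModels GrassmannAlgebra
open Summit.HubbardSuperconductivity.HubbardSuperconductivity.Theorems.KLProgrammeLegKernels
open Summit.HubbardSuperconductivity.HubbardSuperconductivity.Theorems.KLRegimeSplit
open Summit.HubbardSuperconductivity.HubbardSuperconductivity.Theorems.TwoVolumeDefect
open Summit.HubbardSuperconductivity.HubbardSuperconductivity.Theorems.EngineV8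

/-! ## §1 Rows and kernels by copy -/

section Rows

variable {L M : ℕ} [NeZero L]

omit [NeZero L] in
/-- Copy `0` rows: the sector analysis of the alive family `F_J` (row form). [cite: BenfattoGiulianiMastropietro2006, §2.7 (2.70)] -/
theorem klSrcAnalysisAtF_row_alive (β μ : ℝ) (K : TrigPolyC4v) (F : Fin 1 → FreqMomentum L M → ℂ) (J : ℕ) (Y : SrcLabel L M J) (hY : Y.2 = 0) :
    klSrcAnalysisAtF L M β μ K F J Y = sectorAnalysisMatrix L M β (klAnisoFamily L M β μ K klE0 J) Y.1 := by
  ext X; exact klSrcAnalysisAtF_apply_alive β μ K F J Y hY X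

omit [NeZero L] in
/-- Copy `1` rows in sector slot `0`: the `F`-analysis at the relabelled label (row form). [cite: BenfattoGiulianiMastropietro2006, §2.9 (4.6)] -/
theorem klSrcAnalysisAtF_row_src (β μ : ℝ) (K : TrigPolyC4v) (F : Fin 1 → FreqMomentum L M → ℂ) (J : ℕ) (Y : SrcLabel L M J) (hY : Y.2 = 1)
    (h0 : (Y.1.2.1.1 : ℕ) = 0) :
    klSrcAnalysisAtF L M β μ K F J Y = sectorAnalysisMatrix L M β F (Y.1.1, (((0 : Fin 1), Y.1.2.1.2), Y.1.2.2)) := by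
  ext X; exact klSrcAnalysisAtF_apply_src β μ K F J Y hY h0 X

omit [NeZero L] in
/-- Copy `1` rows outside sector slot `0` are dead (row form). [folklore] -/
theorem klSrcAnalysisAtF_row_dead (β μ : ℝ) (K : TrigPolyC4v) (F : Fin 1 → FreqMomentum L M → ℂ) (J : ℕ) (Y : SrcLabel L M J) (hY : Y.2 = 1)
    (h0 : (Y.1.2.1.1 : ℕ) ≠ 0) : klSrcAnalysisAtF L M β μ K F J Y = 0 := by
  ext X; exact klSrcAnalysisAtF_apply_dead β μ K F J Y hY h0 X

/-- **All-alive strings read the `F_J`-sectorised kernels of `𝒱⁽ⁿ⁾`** — independently of the source family `F`. [cite: BenfattoGiulianiMastropietro2006, §2.7 (2.70)] -/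
theorem kernel_klSrcActionAtF_alive (β U μ : ℝ) (K : TrigPolyC4v) (F : Fin 1 → FreqMomentum L M → ℂ) (J n m : ℕ) (X : Fin m → SrcLabel L M J)
    (hX : ∀ i, (X i).2 = 0) :
    kernel ℂ (klSrcActionAtF L M β U μ K F J n) m X =
      sectorisedKernel L M β (klAnisoFamily L M β μ K klE0 J) (klEffectiveAction L M β U μ K klE0 n) m
        (fun i => (X i).1.2) (fun i => (X i).1.1) := by
  rw [klSrcActionAtF, kernel_map_toLin'_eq_of_rows_eq (klSrcAnalysisAtF L M β μ K F J)
      (sectorAnalysisMatrix L M β (klAnisoFamily L M β μ K klE0 J)) _ m X (fun i => (X i).1) fun i => klSrcAnalysisAtF_row_alive β μ K F J (X i) (hX i),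
    kernel_map_sectorAnalysis]

/-- **All-source slot-`0` strings read the `F`-sectorised position-space kernels of `𝒱⁽ⁿ⁾`** — independently of the alive family `F_J`.
[cite: BenfattoGiulianiMastropietro2006, §2.9 (4.3)-(4.6)] -/
theorem kernel_klSrcActionAtF_src (β U μ : ℝ) (K : TrigPolyC4v) (F : Fin 1 → FreqMomentum L M → ℂ) (J n m : ℕ) (X : Fin m → SrcLabel L M J)
    (hX : ∀ i, (X i).2 = 1) (h0 : ∀ i, ((X i).1.2.1.1 : ℕ) = 0) :
    kernel ℂ (klSrcActionAtF L M β U μ K F J n) m X =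
      sectorisedKernel L M β F (klEffectiveAction L M β U μ K klE0 n) m
        (fun i => ((((0 : Fin 1), (X i).1.2.1.2), (X i).1.2.2) : SectorLeg 1)) (fun i => (X i).1.1) := by
  rw [klSrcActionAtF, kernel_map_toLin'_eq_of_rows_eq (klSrcAnalysisAtF L M β μ K F J) (sectorAnalysisMatrix L M β F) _ m X
      (fun i => ((X i).1.1, (((0 : Fin 1), (X i).1.2.1.2), (X i).1.2.2))) fun i => klSrcAnalysisAtF_row_src β μ K F J (X i) (hX i) (h0 i),
    kernel_map_sectorAnalysis]

/-- A copy-`1` leg outside sector slot `0` kills the string. [folklore] -/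
theorem kernel_klSrcActionAtF_eq_zero_of_dead (β U μ : ℝ) (K : TrigPolyC4v) (F : Fin 1 → FreqMomentum L M → ℂ) (J n m : ℕ) (X : Fin m → SrcLabel L M J)
    {i : Fin m} (hX : (X i).2 = 1) (h0 : ((X i).1.2.1.1 : ℕ) ≠ 0) :
    kernel ℂ (klSrcActionAtF L M β U μ K F J n) m X = 0 := by
  rw [klSrcActionAtF]
  exact kernel_map_toLin'_eq_zero_of_row_eq_zero _ _ m X (i := i) (klSrcAnalysisAtF_row_dead β μ K F J (X i) hX h0)

omit [NeZero L] in
/-- A scalar multiple of the analysis matrix is a row scaling by the constant weight. [folklore] -/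
theorem smul_klSrcAnalysisAtF_apply (c : ℂ) (β μ : ℝ) (K : TrigPolyC4v) (F : Fin 1 → FreqMomentum L M → ℂ) (J : ℕ) (p : SrcLabel L M J)
    (X : HubbardFieldIdx L M) :
    (c • klSrcAnalysisAtF L M β μ K F J) p X = (fun _ : SrcLabel L M J => c) p * klSrcAnalysisAtF L M β μ K F J p X := by
  rw [Matrix.smul_apply, smul_eq_mul]

/-- **Kernels of the `c`-scaled object**: `kernel (map (toLin' (c • klSrcAnalysisAtF … F J)) 𝒱_n) m X = c^m · kernel (klSrcActionAtF … F J n) m X`.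
[cite: BenfattoGiulianiMastropietro2006, §2.7 (2.70)-(2.71)] -/
theorem kernel_map_smul_klSrcAnalysisAtF (c : ℂ) (β U μ : ℝ) (K : TrigPolyC4v) (F : Fin 1 → FreqMomentum L M → ℂ) (J n m : ℕ)
    (X : Fin m → SrcLabel L M J) :
    kernel ℂ (ExteriorAlgebra.map (Matrix.toLin' (c • klSrcAnalysisAtF L M β μ K F J)) (klEffectiveAction L M β U μ K klE0 n)) m X =
      c ^ m * kernel ℂ (klSrcActionAtF L M β U μ K F J n) m X := by
  rw [map_toLin'_eq_map_mulLeft_map_of_rowScale (fun _ : SrcLabel L M J => c) (c • klSrcAnalysisAtF L M β μ K F J) (klSrcAnalysisAtF L M β μ K F J)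
      (smul_klSrcAnalysisAtF_apply c β μ K F J) (klEffectiveAction L M β U μ K klE0 n), kernel_map_mulLeft, Fin.prod_const]
  rfl

end Rows

/-! ## §2 Parity -/

section Parity

variable {L M : ℕ} [NeZero L] [NeZero M]

/-- The `F`-analysed action is even (`β ≠ 0`). [folklore] -/
theorem klSrcActionAtF_mem_evenPart {β : ℝ} (hβ : β ≠ 0) (U μ : ℝ) (K : TrigPolyC4v) (F : Fin 1 → FreqMomentum L M → ℂ) (J n : ℕ) :
    klSrcActionAtF L M β U μ K F J n ∈ evenPart ℂ (SrcLabel L M J) := by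
  unfold klSrcActionAtF
  exact mem_evenPart_iff.2 (map_mem_evenOdd_zero ℂ _ (mem_evenPart_iff.1 (klEffectiveAction_mem_evenPart hβ U μ K klE0 n)))

/-- **Odd degrees carry nothing**: `klSrcPinnedSumAtF … m q w = 0` for odd `m` (`β ≠ 0`). [folklore] -/
theorem klSrcPinnedSumAtF_eq_zero_of_odd {β : ℝ} (hβ : β ≠ 0) (U μ : ℝ) (K : TrigPolyC4v) (F : Fin 1 → FreqMomentum L M → ℂ) (J r n s : ℕ) {m : ℕ}
    (hm : Odd m) (q : Fin m) (w : SrcLabel L M J) : klSrcPinnedSumAtF L M β U μ K F J r n s m q w = 0 := by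
  rw [klSrcPinnedSumAtF_def]
  refine mul_eq_zero_of_right _ (sum_eq_zero fun X _ => ?_)
  rw [kernel_eq_zero_of_mem_evenPart_of_odd ℂ (klSrcActionAtF_mem_evenPart hβ U μ K F J n) hm X, norm_zero, mul_zero]

/-- **The `F`-read-out is even with no constant part** (`Z^K_{Λ_{k+1}} ≠ 0`). [folklore] -/
theorem klTowerDF_parity (β U μ : ℝ) (K : TrigPolyC4v) (F : Fin 1 → FreqMomentum L M → ℂ) (k : ℕ)
    (hZ : hubbardEffPartitionFnCT L M β U μ 0 K (klScale klE0 (k + 1)) ≠ 0) :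
    klTowerDF L M β U μ K F k ∈ evenOdd ℂ 0 ∧ constPart ℂ (klTowerDF L M β U μ K F k) = 0 := by
  refine ⟨?_, ?_⟩
  · rw [klTowerDF_def]
    exact map_mem_evenOdd_zero ℂ _ (KLRegimeWick.klEffectiveAction_mem_evenOdd_zero β U μ K klE0 (k + 1))
  · rw [klTowerDF_def, constPart_map]
    exact constPart_klEffectiveAction_eq_zero β U μ K klE0 (k + 1) hZ

/-- The `F`-read-out is even (`evenPart` form, `β ≠ 0`). [folklore] -/
theorem klTowerDF_mem_evenPart {β : ℝ} (hβ : β ≠ 0) (U μ : ℝ) (K : TrigPolyC4v) (F : Fin 1 → FreqMomentum L M → ℂ) (k : ℕ) :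
    klTowerDF L M β U μ K F k ∈ evenPart ℂ (SrcLabel L M k) := by
  rw [klTowerDF_def]
  exact mem_evenPart_iff.2 (map_mem_evenOdd_zero ℂ _ (mem_evenPart_iff.1 (klEffectiveAction_mem_evenPart hβ U μ K klE0 (k + 1))))

end Parity

/-! ## §3 The read-out's species sums and two comparisons -/

section Sums

variable {V M : ℕ} [NeZero V] [NeZero M]

/-- **The kernels of the `F`-read-out carry `ε^m`**: `‖kernel (klTowerDF … F j) m X‖ = ε^m · ‖kernel (klSrcActionAtF … F j (j+1)) m X‖` (`0 ≤ β`). [folklore] -/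
theorem norm_kernel_klTowerDF_eq {β : ℝ} (hβ : 0 ≤ β) (U μ : ℝ) (K : TrigPolyC4v) (F : Fin 1 → FreqMomentum V M → ℂ) (j m : ℕ) (X : Fin m → SrcLabel V M j) :
    ‖kernel ℂ (klTowerDF V M β U μ K F j) m X‖ = imagTimeWeight β M ^ m * ‖kernel ℂ (klSrcActionAtF V M β U μ K F j (j + 1)) m X‖ := by
  have hε : 0 ≤ imagTimeWeight β M := by unfold imagTimeWeight; positivity
  rw [klTowerDF_def, kernel_map_smul_klSrcAnalysisAtF, norm_mul, norm_pow, Complex.norm_real, Real.norm_of_nonneg hε]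

/-- **The `srcCount = s` part of the weighted pinned sum of `klTowerDF … F j` in degree `m ≥ 1` is `ε · klSrcPinnedSumAtF … F j r (j+1) s m`** (`0 ≤ β`). [folklore] -/
theorem sum_srcCount_filter_eq_eps_mul_klSrcPinnedSumAtF {β : ℝ} (hβ : 0 ≤ β) (U μ : ℝ) (K : TrigPolyC4v) (F : Fin 1 → FreqMomentum V M → ℂ)
    (j r s m : ℕ) (hm : 1 ≤ m) (q : Fin m) (w : SrcLabel V M j) :
    ∑ Y ∈ univ.filter (fun Y : Fin m → SrcLabel V M j => Y q = w ∧ srcCount (fun q : SrcLabel V M j => q.2 = 1) Y = s),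
        klScaleWt V M β r ((univ.image Y).image (srcLegPos V M (2 * (2 * M)))) * ‖kernel ℂ (klTowerDF V M β U μ K F j) m Y‖ =
      imagTimeWeight β M * klSrcPinnedSumAtF V M β U μ K F j r (j + 1) s m q w := by
  rw [klSrcPinnedSumAtF_def, mul_sum, mul_sum]
  refine sum_congr rfl fun Y _ => ?_
  have hpow : imagTimeWeight β M ^ m = imagTimeWeight β M * imagTimeWeight β M ^ (m - 1) := by
    rw [← pow_succ', Nat.sub_add_cancel hm]
  rw [norm_kernel_klTowerDF_eq hβ, hpow]
  ring

omit [NeZero M] in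
/-- **Rate monotonicity**: a larger rate index gives a smaller weighted sum (`klScaleWt` is antitone in the rate). [folklore] -/
theorem klSrcPinnedSumAtF_anti_rate {β : ℝ} (hβ : 0 ≤ β) (U μ : ℝ) (K : TrigPolyC4v) (F : Fin 1 → FreqMomentum V M → ℂ) (J n s m : ℕ) {r r' : ℕ}
    (h : r ≤ r') (q : Fin m) (w : SrcLabel V M J) :
    klSrcPinnedSumAtF V M β U μ K F J r' n s m q w ≤ klSrcPinnedSumAtF V M β U μ K F J r n s m q w := by
  rw [klSrcPinnedSumAtF_def, klSrcPinnedSumAtF_def]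
  exact mul_le_mul_of_nonneg_left (sum_le_sum fun X _ => mul_le_mul_of_nonneg_right (klScaleWt_le_of_le β h _) (norm_nonneg _))
    (pow_nonneg (imagTimeWeight_nonneg hβ M) _)

omit [NeZero M] in
/-- **The alive species of the `F`-carrier is E1's read-out** (`F`-free): `klSrcPinnedSumAtF … F J r n 0 m q w ≤ klWtPinnedSumAt … J r m 𝒱_n q w.1`.
[cite: BenfattoGiulianiMastropietro2006, §2.7 (2.70)-(2.71)] -/
theorem klSrcPinnedSumAtF_zero_le_klWtPinnedSumAt {β : ℝ} (hβ : 0 ≤ β) (U μ : ℝ) (K : TrigPolyC4v) (F : Fin 1 → FreqMomentum V M → ℂ) (J r n m : ℕ)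
    (q : Fin m) (w : SrcLabel V M J) :
    klSrcPinnedSumAtF V M β U μ K F J r n 0 m q w ≤ klWtPinnedSumAt V M β μ K J r m (klEffectiveAction V M β U μ K klE0 n) q w.1 := by
  classical
  rw [klSrcPinnedSumAtF_def]
  unfold klWtPinnedSumAt
  refine mul_le_mul_of_nonneg_left ?_ (pow_nonneg (imagTimeWeight_nonneg hβ M) _)
  set A := univ.filter (fun X : Fin m → SrcLabel V M J => X q = w ∧ srcCount (fun q : SrcLabel V M J => q.2 = 1) X = 0) with hA
  set e : (Fin m → SrcLabel V M J) → (Fin m → SpaceTimeIdx V M × SectorLeg (sectorCount J)) := fun X i => (X i).1 with he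
  set g : (Fin m → SpaceTimeIdx V M × SectorLeg (sectorCount J)) → ℝ := fun Xa =>
    klScaleWt V M β r ((univ.image Xa).image (latticeLegPos (2 * (2 * M)))) *
      ‖kernel ℂ (ExteriorAlgebra.map (Matrix.toLin' (sectorAnalysisMatrix V M β (klAnisoFamily V M β μ K klE0 J)))
        (klEffectiveAction V M β U μ K klE0 n)) m Xa‖ with hg
  have hcopy : ∀ X ∈ A, ∀ i, (X i).2 = 0 := fun X hX => by
    simp only [hA, mem_filter, mem_univ, true_and] at hX
    exact (srcCount_eq_zero_iff X).1 hX.2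
  have hinj : Set.InjOn e A := by
    intro X hX X' hX' hXX'
    funext i
    have h1 : (X i).1 = (X' i).1 := congrFun hXX' i
    have h2 : (X i).2 = (X' i).2 := by rw [hcopy X hX i, hcopy X' hX' i]
    exact Prod.ext h1 h2
  have hfg : ∀ X ∈ A, klScaleWt V M β r ((univ.image X).image (srcLegPos V M (2 * (2 * M)))) * ‖kernel ℂ (klSrcActionAtF V M β U μ K F J n) m X‖ =
      g (e X) := by
    intro X hX
    simp only [hg, he]
    rw [image_image, image_image, kernel_klSrcActionAtF_alive β U μ K F J n m X (hcopy X hX), kernel_map_sectorAnalysis]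
    rfl
  have hsub : A.image e ⊆ univ.filter (fun Xa : Fin m → SpaceTimeIdx V M × SectorLeg (sectorCount J) => Xa q = w.1) := by
    intro Xa hXa
    simp only [mem_image] at hXa
    obtain ⟨X, hX, rfl⟩ := hXa
    simp only [hA, mem_filter, mem_univ, true_and] at hX
    simp only [mem_filter, mem_univ, true_and, he, hX.1]
  have hg0 : ∀ Xa, 0 ≤ g Xa := fun Xa => mul_nonneg (zero_le_one.trans (one_le_klScaleWt _ _ _ _ _)) (norm_nonneg _)
  calc ∑ X ∈ A, klScaleWt V M β r ((univ.image X).image (srcLegPos V M (2 * (2 * M)))) * ‖kernel ℂ (klSrcActionAtF V M β U μ K F J n) m X‖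
      = ∑ X ∈ A, g (e X) := sum_congr rfl hfg
    _ = ∑ Xa ∈ A.image e, g Xa := (sum_image hinj).symm
    _ ≤ _ := sum_le_sum_of_subset_of_nonneg hsub fun Xa _ _ => hg0 Xa

end Sums

end Summit.HubbardSuperconductivity.HubbardSuperconductivity.Theorems.TwoVolumeSource

end
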